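import Literature.AlgebraicGeometry.AbelianSchemes.AbelianSchemeDualTransportOfBaseChange
import Literature.AlgebraicGeometry.AbelianSchemes.AbelianSchemeOverZariskiGluingPolarization
import HarnessLib

/-!
# The `PolarizationDatum` INPUT of the glued triple from DUAL-PAIR UNIQUENESS (road (D-F3) of hand (h7))

Topic `AlgebraicGeometry/AbelianSchemes`; namespace
`Literature.AlgebraicGeometry.AbelianSchemes.AbelianSchemeOver.ZariskiGluingDatum`.  Cell hodgecm-mathlib (D-0151),
F-DAG hand (h7) «Zariski gluing of `S`-objects from a cocycle», the ONE input its chain ★ (P1) `PolarizationDatum` →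
(P2) clauses → (P3) `glueTriple` left declared: the charts of duals `Ĝᵢ : Âᵢ → Ẑ` over `Uᵢ → S` with their
group-scheme clause `hĜ` and POINCARÉ clause `(χᵢ × Ĝᵢ)^*𝒫₀ ≅ 𝒫ᵢ`, and the overlap agreement `compat` of the
`λᵢ ≫ Ĝᵢ`.  Road (D-F3) of the cell (census `CENSUS-h7-TripleLayer`): the dual pair `D₀ = (Ẑ, 𝒫₀)` of the GLUED abelian
scheme is taken as given ([MumfordFogartyKirwan1994, Ch. 6 §1 Cor. 6.8] applied to `Z/S` — not glued), and everything
upstairs follows from the UNIQUENESS of dual pairs ([MilneAV2008, I §8]: unique up to a unique isomorphism) in the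
form of FILE A ★ `AbelianSchemeDualTransportOfBaseChange` (the dual transport `hatTransportOfBaseChange` along a
base-change square, its Poincaré clause, uniqueness, and group-scheme clause).

INPUT (`PolarizationChartDatum 𝔇 D₀`, what F-8 (8c) holds on the slices `V_R`): on every chart a dual pair `Dᵢ` and a
polarisation `λᵢ` of `Aᵢ` ([MumfordFogartyKirwan1994, Def. 6.3]); on every overlap `Uᵢ ×_S Uⱼ` a dual pair `Dᵢⱼ` of
`Aᵢⱼ`, a morphism `λᵢⱼ : Aᵢⱼ → Âᵢⱼ`, and charts of duals `Ĝ₁ : Âᵢⱼ → Âᵢ`, `Ĝ₂ : Âᵢⱼ → Âⱼ` over the two projections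
carrying the Poincaré clauses `(κ₁ × Ĝ₁)^*𝒫ᵢ ≅ 𝒫ᵢⱼ`, `(κ₂ × Ĝ₂)^*𝒫ⱼ ≅ 𝒫ᵢⱼ` and the `λ`-clauses
`λᵢⱼ ≫ Ĝ₁ = κ₁ ≫ λᵢ`, `λᵢⱼ ≫ Ĝ₂ = κ₂ ≫ λⱼ` of [MumfordFogartyKirwan1994, Def. 7.2/7.3] (the pull-back relation of
polarised abelian schemes along `κ₁`, `κ₂`; e.g. restrictions of ONE polarised family and the transition
isomorphisms of triples).  OUTPUT:

* §1 `Ĝ i := hatTransportOfBaseChange D₀ (Dc i) (𝔇.isBaseChangeVia_abelianScheme i)` with `Ĝ_comp_hom`, the Poincaré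
  clause `poincare`, uniqueness `eq_Ĝ`;
* §2 **`compat`** — `κ₁ ≫ λᵢ ≫ Ĝᵢ = κ₂ ≫ λⱼ ≫ Ĝⱼ` on `Aᵢⱼ`: by the `λ`-clauses both sides are `λᵢⱼ ≫ (Ĝₖ ≫ Ĝ)`, and
  `Ĝ₁ ≫ Ĝᵢ = Ĝ₂ ≫ Ĝⱼ` because BOTH are dual transports along the square `Aᵢⱼ → Z` over `Uᵢ ×_S Uⱼ → S` carrying the
  composite Poincaré clause (FILE A `nonempty_pullback_map_comp_iso` + `eq_hatTransportOfBaseChange_of_nonempty_pullback_map_iso`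
  + `hatTransportOfBaseChange_congr` along `κ₁ ≫ χᵢ = κ₂ ≫ χⱼ`, `pr₁ ≫ (Uᵢ → S) = pr₂ ≫ (Uⱼ → S)`);
* §3 **`toPolarizationDatum (hĜ)`** — the ★ (P1) `PolarizationDatum 𝔇 D₀` for any proof of the group-scheme clauses
  `hĜ`, and **`hĜ_of_isLocallyNoetherian`** discharging them over connected locally Noetherian charts under the unit
  hypotheses `𝒫|_{A × {ε_Â}} ≅ 𝒪` (FILE A `hat_isBaseChangeVia_hatTransportOfBaseChange_of_isLocallyNoetherian`, i.e. ★
  p759971 [MumfordFogartyKirwan1994, Cor. 6.4] in Stein form); **`polarizationDatum`** = the composite, so that ★ (P1)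
  `polarization`, (P2) `hasType_polarization`/`isSymplecticLiftable_levelStructure`, (P3) `glueTriple` /
  `isBaseChangeVia_chartTriple` apply BY NAME: the glued TRIPLE over `S` from chart triples, overlap isomorphisms and
  `D₀` alone.

No named fact, no `sorry`, no instance, no notation.  HC_CM is proved only modulo the printed citations until rung 0
closes; this file discharges none of them.

## References
* [MumfordFogartyKirwan1994] D. Mumford, J. Fogarty, F. Kirwan, *Geometric Invariant Theory*, 3rd ed. (1994), Ch. 6 §1
  Cor. 6.4 (p. 117), Cor. 6.8 (p. 118); §2 Def. 6.3 (p. 120); Ch. 7 §2 Def. 7.2 (p. 129), Def. 7.3 (p. 129).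
* [MilneAV2008] J. S. Milne, *Abelian Varieties* (v2.00, 2008), I §8 pp. 36–37.
* [GortzWedhorn2020] U. Görtz, T. Wedhorn, *Algebraic Geometry I*, 2nd ed. (2020), Section (3.3) Prop. 3.5; Section (4.15)
  (p. 116).
-/

universe u

open CategoryTheory CategoryTheory.Limits AlgebraicGeometry MonoidalCategory

noncomputable section

namespace Literature.AlgebraicGeometry.AbelianSchemes

namespace AbelianSchemeOver

namespace ZariskiGluingDatum

open scoped MonObj

variable {S : Scheme.{u}} {𝔇 : ZariskiGluingDatum S}

variable (𝔇) in
/-- **Chartwise polarisation data WITHOUT the charts of duals** (what a consumer gluing slices of one polarised family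
holds): dual pairs `Dᵢ` and polarisations `λᵢ` on the charts `Aᵢ/Uᵢ` ([MumfordFogartyKirwan1994, Def. 6.3]); on the
overlaps `Uᵢ ×_S Uⱼ` a dual pair `Dᵢⱼ` of `Aᵢⱼ`, a morphism `λᵢⱼ : Aᵢⱼ → Âᵢⱼ` and charts of duals `Ĝ₁ : Âᵢⱼ → Âᵢ`,
`Ĝ₂ : Âᵢⱼ → Âⱼ` over the two projections, carrying the POINCARÉ clauses `(κ₁ × Ĝ₁)^*𝒫ᵢ ≅ 𝒫ᵢⱼ`,
`(κ₂ × Ĝ₂)^*𝒫ⱼ ≅ 𝒫ᵢⱼ` (stated exactly as in ★ `PolarizedAbelianSchemeWithLevel.IsBaseChangeVia`) and the `λ`-clauses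
`λᵢⱼ ≫ Ĝ₁ = κ₁ ≫ λᵢ`, `λᵢⱼ ≫ Ĝ₂ = κ₂ ≫ λⱼ` of [MumfordFogartyKirwan1994, Def. 7.2/7.3]. [cite: MumfordFogartyKirwan1994, Ch. 7 §2 Definition 7.2 (p. 129)]
[cite: MumfordFogartyKirwan1994, Ch. 6 §2 Definition 6.3 (p. 120)] -/
structure PolarizationChartDatum where
  /-- the dual pair `(Âᵢ, 𝒫ᵢ)` of the chart `Aᵢ/Uᵢ` -/
  Dc : ∀ i, (𝔇.A i).DualPair
  /-- the polarisation `λᵢ : Aᵢ → Âᵢ` of the chart -/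
  pol : ∀ i, (𝔇.A i).Polarization (Dc i)
  /-- the dual pair `(Âᵢⱼ, 𝒫ᵢⱼ)` of the overlap family `Aᵢⱼ / Uᵢ ×_S Uⱼ` -/
  D₂ : ∀ i j, (𝔇.A₂ i j).DualPair
  /-- the morphism `λᵢⱼ : Aᵢⱼ → Âᵢⱼ` (only its two `λ`-clauses are used) -/
  lam₂ : ∀ i j, (𝔇.A₂ i j).X.left ⟶ (D₂ i j).hat.X.left
  /-- the chart of duals `Ĝ₁ : Âᵢⱼ → Âᵢ` over `pr₁ : Uᵢ ×_S Uⱼ → Uᵢ` … -/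
  Ĝ₁ : ∀ i j, (D₂ i j).hat.X.left ⟶ (Dc i).hat.X.left
  /-- … and `Ĝ₂ : Âᵢⱼ → Âⱼ` over `pr₂` -/
  Ĝ₂ : ∀ i j, (D₂ i j).hat.X.left ⟶ (Dc j).hat.X.left
  /-- the Poincaré clause `(κ₁ × Ĝ₁)^*𝒫ᵢ ≅ 𝒫ᵢⱼ` (with `Ĝ₁` over `pr₁`) -/
  poincare₁ : ∀ i j, ∃ (wG : (𝔇.A₂ i j).X.hom ≫ pullback.fst (𝔇.𝒰.f i) (𝔇.𝒰.f j) = 𝔇.κ₁ i j ≫ (𝔇.A i).X.hom)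
    (wĜ : (D₂ i j).hat.X.hom ≫ pullback.fst (𝔇.𝒰.f i) (𝔇.𝒰.f j) = Ĝ₁ i j ≫ (Dc i).hat.X.hom),
    Nonempty ((Scheme.Modules.pullback (pullback.map (𝔇.A₂ i j).X.hom (D₂ i j).hat.X.hom (𝔇.A i).X.hom
      (Dc i).hat.X.hom (𝔇.κ₁ i j) (Ĝ₁ i j) (pullback.fst (𝔇.𝒰.f i) (𝔇.𝒰.f j)) wG wĜ)).obj (Dc i).P ≅ (D₂ i j).P)
  /-- the Poincaré clause `(κ₂ × Ĝ₂)^*𝒫ⱼ ≅ 𝒫ᵢⱼ` (with `Ĝ₂` over `pr₂`) -/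
  poincare₂ : ∀ i j, ∃ (wG : (𝔇.A₂ i j).X.hom ≫ pullback.snd (𝔇.𝒰.f i) (𝔇.𝒰.f j) = 𝔇.κ₂ i j ≫ (𝔇.A j).X.hom)
    (wĜ : (D₂ i j).hat.X.hom ≫ pullback.snd (𝔇.𝒰.f i) (𝔇.𝒰.f j) = Ĝ₂ i j ≫ (Dc j).hat.X.hom),
    Nonempty ((Scheme.Modules.pullback (pullback.map (𝔇.A₂ i j).X.hom (D₂ i j).hat.X.hom (𝔇.A j).X.hom
      (Dc j).hat.X.hom (𝔇.κ₂ i j) (Ĝ₂ i j) (pullback.snd (𝔇.𝒰.f i) (𝔇.𝒰.f j)) wG wĜ)).obj (Dc j).P ≅ (D₂ i j).P)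
  /-- the `λ`-clause along `κ₁`: `λᵢⱼ ≫ Ĝ₁ = κ₁ ≫ λᵢ` -/
  lam₂_Ĝ₁ : ∀ i j, lam₂ i j ≫ Ĝ₁ i j = 𝔇.κ₁ i j ≫ (pol i).lam.left
  /-- the `λ`-clause along `κ₂`: `λᵢⱼ ≫ Ĝ₂ = κ₂ ≫ λⱼ` -/
  lam₂_Ĝ₂ : ∀ i j, lam₂ i j ≫ Ĝ₂ i j = 𝔇.κ₂ i j ≫ (pol j).lam.left

/-- The chart square commutes: `Aᵢ → Uᵢ → S` is `χᵢ ≫ (Z → S)`. [cite: MumfordFogartyKirwan1994, Ch. 7 §2 Definition 7.2 (p. 129)] -/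
theorem chart_hom_comp_f (𝔇 : ZariskiGluingDatum S) (i : 𝔇.𝒰.I₀) :
    (𝔇.A i).X.hom ≫ 𝔇.𝒰.f i = 𝔇.χ i ≫ 𝔇.abelianScheme.X.hom :=
  (𝔇.isBaseChangeVia_abelianScheme i).fst.symm

/-- The overlap family `Aᵢⱼ` is a base change of the glued `Z` along `Uᵢ ×_S Uⱼ → S` via `κ₁ ≫ χᵢ` (squares compose,
★ `IsBaseChangeVia.trans`). [cite: MumfordFogartyKirwan1994, Ch. 7 §2 Definition 7.2 (p. 129)] -/
theorem isBaseChangeVia_κ₁_χ (𝔇 : ZariskiGluingDatum S) (i j : 𝔇.𝒰.I₀) :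
    (𝔇.A₂ i j).IsBaseChangeVia 𝔇.abelianScheme (pullback.fst (𝔇.𝒰.f i) (𝔇.𝒰.f j) ≫ 𝔇.𝒰.f i)
      (𝔇.κ₁ i j ≫ 𝔇.χ i) :=
  (𝔇.hκ₁ i j).trans (𝔇.isBaseChangeVia_abelianScheme i)

/-- … and via `κ₂ ≫ χⱼ` along `pr₂ ≫ (Uⱼ → S)`. [cite: MumfordFogartyKirwan1994, Ch. 7 §2 Definition 7.2 (p. 129)] -/
theorem isBaseChangeVia_κ₂_χ (𝔇 : ZariskiGluingDatum S) (i j : 𝔇.𝒰.I₀) :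
    (𝔇.A₂ i j).IsBaseChangeVia 𝔇.abelianScheme (pullback.snd (𝔇.𝒰.f i) (𝔇.𝒰.f j) ≫ 𝔇.𝒰.f j)
      (𝔇.κ₂ i j ≫ 𝔇.χ j) :=
  (𝔇.hκ₂ i j).trans (𝔇.isBaseChangeVia_abelianScheme j)

namespace PolarizationChartDatum

variable (𝔔 : PolarizationChartDatum 𝔇) (D₀ : 𝔇.abelianScheme.DualPair)

/-! ### §1 The charts of duals `Ĝᵢ : Âᵢ → Ẑ` from dual-pair uniqueness -/

/-- **The chart of duals `Ĝᵢ : Âᵢ → Ẑ` over `Uᵢ → S`**: the dual transport along the cartesian chart `χᵢ : Aᵢ → Z`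
(FILE 3b ★ `isBaseChangeVia_abelianScheme`, FILE A `hatTransportOfBaseChange`) — [MilneAV2008, I §8]: the unique map
classifying `𝒫ᵢ` as a family of line bundles on `Z`. [cite: MilneAV2008, I §8 pp. 36–37]
[cite: MumfordFogartyKirwan1994, Ch. 6 §1 Cor. 6.8 (p. 118)] -/
def Ĝ (i : 𝔇.𝒰.I₀) : (𝔔.Dc i).hat.X.left ⟶ D₀.hat.X.left :=
  DualPair.hatTransportOfBaseChange D₀ (𝔔.Dc i) (𝔇.isBaseChangeVia_abelianScheme i)

/-- `Ĝᵢ` lies over `Uᵢ → S`. [cite: MumfordFogartyKirwan1994, Ch. 7 §2 Definition 7.2 (p. 129)] -/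
@[reassoc]
theorem Ĝ_comp_hom (i : 𝔇.𝒰.I₀) : 𝔔.Ĝ D₀ i ≫ D₀.hat.X.hom = (𝔔.Dc i).hat.X.hom ≫ 𝔇.𝒰.f i :=
  DualPair.hatTransportOfBaseChange_comp_hom D₀ (𝔔.Dc i) (𝔇.isBaseChangeVia_abelianScheme i)

/-- **The Poincaré clause `(χᵢ × Ĝᵢ)^*𝒫₀ ≅ 𝒫ᵢ`** of the chart square (FILE A). [cite: MumfordFogartyKirwan1994, Ch. 7 §2 Definition 7.3 (p. 129)]
[cite: MilneAV2008, I §8 pp. 36–37] -/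
theorem poincare (i : 𝔇.𝒰.I₀) :
    ∃ (wG : (𝔇.A i).X.hom ≫ 𝔇.𝒰.f i = 𝔇.χ i ≫ 𝔇.abelianScheme.X.hom)
      (wĜ : (𝔔.Dc i).hat.X.hom ≫ 𝔇.𝒰.f i = 𝔔.Ĝ D₀ i ≫ D₀.hat.X.hom),
      Nonempty ((Scheme.Modules.pullback (pullback.map (𝔇.A i).X.hom (𝔔.Dc i).hat.X.hom 𝔇.abelianScheme.X.hom
        D₀.hat.X.hom (𝔇.χ i) (𝔔.Ĝ D₀ i) (𝔇.𝒰.f i) wG wĜ)).obj D₀.P ≅ (𝔔.Dc i).P) :=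
  ⟨𝔇.chart_hom_comp_f i, (𝔔.Ĝ_comp_hom D₀ i).symm,
    DualPair.nonempty_pullback_map_hatTransportOfBaseChange_iso D₀ (𝔔.Dc i) (𝔇.isBaseChangeVia_abelianScheme i)
      (𝔇.chart_hom_comp_f i) (𝔔.Ĝ_comp_hom D₀ i).symm⟩

/-- **Uniqueness of `Ĝᵢ`**: any `Âᵢ → Ẑ` over `Uᵢ → S` with the Poincaré clause `(χᵢ × ·)^*𝒫₀ ≅ 𝒫ᵢ` is `Ĝᵢ` (FILE A;
[MilneAV2008, I §8] «unique»). [cite: MilneAV2008, I §8 pp. 36–37] -/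
theorem eq_Ĝ (i : 𝔇.𝒰.I₀) (Ĝ' : (𝔔.Dc i).hat.X.left ⟶ D₀.hat.X.left)
    (hĜ' : Ĝ' ≫ D₀.hat.X.hom = (𝔔.Dc i).hat.X.hom ≫ 𝔇.𝒰.f i)
    (hP : Nonempty ((Scheme.Modules.pullback (pullback.map (𝔇.A i).X.hom (𝔔.Dc i).hat.X.hom 𝔇.abelianScheme.X.hom
      D₀.hat.X.hom (𝔇.χ i) Ĝ' (𝔇.𝒰.f i) (𝔇.chart_hom_comp_f i) hĜ'.symm)).obj D₀.P ≅ (𝔔.Dc i).P)) :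
    Ĝ' = 𝔔.Ĝ D₀ i :=
  DualPair.eq_hatTransportOfBaseChange_of_nonempty_pullback_map_iso D₀ (𝔔.Dc i) (𝔇.isBaseChangeVia_abelianScheme i)
    Ĝ' hĜ' (𝔇.chart_hom_comp_f i) hP

/-! ### §2 The overlap agreement `κ₁ ≫ λᵢ ≫ Ĝᵢ = κ₂ ≫ λⱼ ≫ Ĝⱼ` -/

/-- **`Ĝ₁ ≫ Ĝᵢ` is the dual transport along `Aᵢⱼ → Z`**: it lies over `pr₁ ≫ (Uᵢ → S)` and carries the COMPOSITE Poincaré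
clause (FILE A `nonempty_pullback_map_comp_iso`), so uniqueness applies. [cite: MilneAV2008, I §8 pp. 36–37]
[cite: MumfordFogartyKirwan1994, Ch. 7 §2 Definition 7.3 (p. 129)] -/
theorem Ĝ₁_comp_Ĝ (i j : 𝔇.𝒰.I₀) :
    𝔔.Ĝ₁ i j ≫ 𝔔.Ĝ D₀ i =
      DualPair.hatTransportOfBaseChange D₀ (𝔔.D₂ i j) (𝔇.isBaseChangeVia_κ₁_χ i j) := by
  obtain ⟨wG₁, wĜ₁, hP₁⟩ := 𝔔.poincare₁ i j
  obtain ⟨wG, wĜ, hP⟩ := 𝔔.poincare D₀ i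
  have hover : (𝔔.Ĝ₁ i j ≫ 𝔔.Ĝ D₀ i) ≫ D₀.hat.X.hom =
      (𝔔.D₂ i j).hat.X.hom ≫ pullback.fst (𝔇.𝒰.f i) (𝔇.𝒰.f j) ≫ 𝔇.𝒰.f i := by
    rw [Category.assoc, ← wĜ, ← Category.assoc, ← wĜ₁, Category.assoc]
  have wG' : (𝔇.A₂ i j).X.hom ≫ pullback.fst (𝔇.𝒰.f i) (𝔇.𝒰.f j) ≫ 𝔇.𝒰.f i =
      (𝔇.κ₁ i j ≫ 𝔇.χ i) ≫ 𝔇.abelianScheme.X.hom := by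
    rw [Category.assoc, ← wG, ← Category.assoc, wG₁, Category.assoc]
  exact DualPair.eq_hatTransportOfBaseChange_of_nonempty_pullback_map_iso D₀ (𝔔.D₂ i j)
    (𝔇.isBaseChangeVia_κ₁_χ i j) _ hover wG'
    (DualPair.nonempty_pullback_map_comp_iso D₀ (𝔔.Dc i) (𝔔.D₂ i j) wG wĜ wG₁ wĜ₁ hP hP₁ wG' hover.symm)

/-- **`Ĝ₂ ≫ Ĝⱼ` is the dual transport along `Aᵢⱼ → Z`** (same, over `pr₂ ≫ (Uⱼ → S)`). [cite: MilneAV2008, I §8 pp. 36–37]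
[cite: MumfordFogartyKirwan1994, Ch. 7 §2 Definition 7.3 (p. 129)] -/
theorem Ĝ₂_comp_Ĝ (i j : 𝔇.𝒰.I₀) :
    𝔔.Ĝ₂ i j ≫ 𝔔.Ĝ D₀ j =
      DualPair.hatTransportOfBaseChange D₀ (𝔔.D₂ i j) (𝔇.isBaseChangeVia_κ₂_χ i j) := by
  obtain ⟨wG₂, wĜ₂, hP₂⟩ := 𝔔.poincare₂ i j
  obtain ⟨wG, wĜ, hP⟩ := 𝔔.poincare D₀ j
  have hover : (𝔔.Ĝ₂ i j ≫ 𝔔.Ĝ D₀ j) ≫ D₀.hat.X.hom =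
      (𝔔.D₂ i j).hat.X.hom ≫ pullback.snd (𝔇.𝒰.f i) (𝔇.𝒰.f j) ≫ 𝔇.𝒰.f j := by
    rw [Category.assoc, ← wĜ, ← Category.assoc, ← wĜ₂, Category.assoc]
  have wG' : (𝔇.A₂ i j).X.hom ≫ pullback.snd (𝔇.𝒰.f i) (𝔇.𝒰.f j) ≫ 𝔇.𝒰.f j =
      (𝔇.κ₂ i j ≫ 𝔇.χ j) ≫ 𝔇.abelianScheme.X.hom := by
    rw [Category.assoc, ← wG, ← Category.assoc, wG₂, Category.assoc]
  exact DualPair.eq_hatTransportOfBaseChange_of_nonempty_pullback_map_iso D₀ (𝔔.D₂ i j)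
    (𝔇.isBaseChangeVia_κ₂_χ i j) _ hover wG'
    (DualPair.nonempty_pullback_map_comp_iso D₀ (𝔔.Dc j) (𝔔.D₂ i j) wG wĜ wG₂ wĜ₂ hP hP₂ wG' hover.symm)

/-- **The two dual transports from `Âᵢⱼ` to `Ẑ` agree**: `Ĝ₁ ≫ Ĝᵢ = Ĝ₂ ≫ Ĝⱼ` — the squares `(κ₁ ≫ χᵢ, pr₁ ≫ (Uᵢ → S))` and
`(κ₂ ≫ χⱼ, pr₂ ≫ (Uⱼ → S))` are the SAME square (`𝔇.hκ`, `pullback.condition`), and the dual transport depends only on it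
(FILE A `hatTransportOfBaseChange_congr`). [cite: MilneAV2008, I §8 pp. 36–37] [cite: GortzWedhorn2020, Section (3.3) Proposition 3.5] -/
theorem Ĝ₁_comp_Ĝ_eq_Ĝ₂_comp_Ĝ (i j : 𝔇.𝒰.I₀) : 𝔔.Ĝ₁ i j ≫ 𝔔.Ĝ D₀ i = 𝔔.Ĝ₂ i j ≫ 𝔔.Ĝ D₀ j := by
  rw [Ĝ₁_comp_Ĝ, Ĝ₂_comp_Ĝ]
  exact DualPair.hatTransportOfBaseChange_congr D₀ (𝔔.D₂ i j) (𝔇.isBaseChangeVia_κ₁_χ i j) pullback.condition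
    (𝔇.hκ i j) (𝔇.isBaseChangeVia_κ₂_χ i j)

/-- **THE OVERLAP AGREEMENT** `κ₁ ≫ λᵢ ≫ Ĝᵢ = κ₂ ≫ λⱼ ≫ Ĝⱼ : Aᵢⱼ → Ẑ` (the `compat` field of ★ (P1) `PolarizationDatum`):
by the `λ`-clauses both sides equal `λᵢⱼ ≫ Ĝₖ ≫ Ĝ`, and `Ĝ₁ ≫ Ĝᵢ = Ĝ₂ ≫ Ĝⱼ`. [cite: GortzWedhorn2020, Section (3.3) Proposition 3.5]
[cite: MumfordFogartyKirwan1994, Ch. 7 §2 Definition 7.2 (p. 129)] -/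
theorem compat (i j : 𝔇.𝒰.I₀) :
    𝔇.κ₁ i j ≫ (𝔔.pol i).lam.left ≫ 𝔔.Ĝ D₀ i = 𝔇.κ₂ i j ≫ (𝔔.pol j).lam.left ≫ 𝔔.Ĝ D₀ j := by
  rw [← Category.assoc, ← 𝔔.lam₂_Ĝ₁ i j, Category.assoc, 𝔔.Ĝ₁_comp_Ĝ_eq_Ĝ₂_comp_Ĝ D₀ i j, ← Category.assoc,
    𝔔.lam₂_Ĝ₂ i j, Category.assoc]

/-! ### §3 The `PolarizationDatum` -/

/-- **The ★ (P1) `PolarizationDatum` of `𝔇` and `D₀` from chart data and ANY proof of the group-scheme clauses `hĜ`**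
(`Ĝ`, `poincare`, `compat` from §1–§2). [cite: MumfordFogartyKirwan1994, Ch. 7 §2 Definition 7.2 (p. 129)]
[cite: MumfordFogartyKirwan1994, Ch. 6 §2 Definition 6.3 (p. 120)] -/
def toPolarizationDatum (hĜ : ∀ i, (𝔔.Dc i).hat.IsBaseChangeVia D₀.hat (𝔇.𝒰.f i) (𝔔.Ĝ D₀ i)) :
    PolarizationDatum 𝔇 D₀ where
  Dc := 𝔔.Dc
  pol := 𝔔.pol
  Ĝ := 𝔔.Ĝ D₀
  hĜ := hĜ
  poincare := 𝔔.poincare D₀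
  compat := 𝔔.compat D₀

/-- The dual pairs of `toPolarizationDatum` are the given ones (definitional). [cite: MumfordFogartyKirwan1994, Ch. 7 §2 Definition 7.2 (p. 129)] -/
theorem toPolarizationDatum_Dc (hĜ : ∀ i, (𝔔.Dc i).hat.IsBaseChangeVia D₀.hat (𝔇.𝒰.f i) (𝔔.Ĝ D₀ i)) :
    (𝔔.toPolarizationDatum D₀ hĜ).Dc = 𝔔.Dc := rfl

/-- The polarisations of `toPolarizationDatum` are the given ones (definitional). [cite: MumfordFogartyKirwan1994, Ch. 6 §2 Definition 6.3 (p. 120)] -/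
theorem toPolarizationDatum_pol (hĜ : ∀ i, (𝔔.Dc i).hat.IsBaseChangeVia D₀.hat (𝔇.𝒰.f i) (𝔔.Ĝ D₀ i)) :
    (𝔔.toPolarizationDatum D₀ hĜ).pol = 𝔔.pol := rfl

/-- The charts of duals of `toPolarizationDatum` are the dual transports `Ĝᵢ` (definitional). [cite: MilneAV2008, I §8 pp. 36–37] -/
theorem toPolarizationDatum_Ĝ (hĜ : ∀ i, (𝔔.Dc i).hat.IsBaseChangeVia D₀.hat (𝔇.𝒰.f i) (𝔔.Ĝ D₀ i)) :
    (𝔔.toPolarizationDatum D₀ hĜ).Ĝ = 𝔔.Ĝ D₀ := rfl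

/-- **The group-scheme clauses `hĜ` over connected locally Noetherian charts** under the unit hypotheses
`𝒫₀|_{Z × {ε_Ẑ}} ≅ 𝒪`, `𝒫ᵢ|_{Aᵢ × {ε_{Âᵢ}}} ≅ 𝒪` (FILE A `hat_isBaseChangeVia_hatTransportOfBaseChange_of_isLocallyNoetherian`;
[MumfordFogartyKirwan1994, Cor. 6.4]: a unit-preserving morphism of abelian schemes over a connected locally Noetherian
base is a homomorphism, ★ p759971). [cite: MumfordFogartyKirwan1994, Ch. 6 §1 Corollary 6.4 (p. 117) and Cor. 6.8 (p. 118)]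
[cite: MilneAV2008, I §8 pp. 36–37] -/
theorem hĜ_of_isLocallyNoetherian [∀ i, IsLocallyNoetherian (𝔇.𝒰.X i)] [∀ i, PreconnectedSpace (𝔇.𝒰.X i)]
    (unit₀ : Nonempty ((Scheme.Modules.pullback (DualPair.unitHatSlice D₀)).obj D₀.P ≅ SheafOfModules.unit _))
    (unit : ∀ i, Nonempty ((Scheme.Modules.pullback (DualPair.unitHatSlice (𝔔.Dc i))).obj (𝔔.Dc i).P ≅
      SheafOfModules.unit _)) (i : 𝔇.𝒰.I₀) :
    (𝔔.Dc i).hat.IsBaseChangeVia D₀.hat (𝔇.𝒰.f i) (𝔔.Ĝ D₀ i) :=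
  DualPair.hat_isBaseChangeVia_hatTransportOfBaseChange_of_isLocallyNoetherian D₀ (𝔔.Dc i)
    (𝔇.isBaseChangeVia_abelianScheme i) unit₀ (unit i)

/-- **THE `PolarizationDatum` OF ROAD (D-F3)**: chart dual pairs and polarisations, overlap compatibility data, and the
dual pair `D₀` of the glued scheme, over connected locally Noetherian charts under the unit hypotheses — hence, BY NAME,
the glued polarisation ★ (P1) `PolarizationDatum.polarization`, its clauses (P2) and the glued triple (P3) `glueTriple`
with cartesian charts `isBaseChangeVia_chartTriple`. [cite: MumfordFogartyKirwan1994, Ch. 7 §2 Definition 7.2 (p. 129)]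
[cite: MumfordFogartyKirwan1994, Ch. 6 §1 Cor. 6.8 (p. 118)] [cite: MilneAV2008, I §8 pp. 36–37] -/
def polarizationDatum [∀ i, IsLocallyNoetherian (𝔇.𝒰.X i)] [∀ i, PreconnectedSpace (𝔇.𝒰.X i)]
    (unit₀ : Nonempty ((Scheme.Modules.pullback (DualPair.unitHatSlice D₀)).obj D₀.P ≅ SheafOfModules.unit _))
    (unit : ∀ i, Nonempty ((Scheme.Modules.pullback (DualPair.unitHatSlice (𝔔.Dc i))).obj (𝔔.Dc i).P ≅
      SheafOfModules.unit _)) :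
    PolarizationDatum 𝔇 D₀ :=
  𝔔.toPolarizationDatum D₀ (𝔔.hĜ_of_isLocallyNoetherian D₀ unit₀ unit)

/-- `polarizationDatum` is `toPolarizationDatum` on the Noetherian discharge of `hĜ` (definitional).
[cite: MumfordFogartyKirwan1994, Ch. 6 §1 Corollary 6.4 (p. 117)] -/
theorem polarizationDatum_eq [∀ i, IsLocallyNoetherian (𝔇.𝒰.X i)] [∀ i, PreconnectedSpace (𝔇.𝒰.X i)]
    (unit₀ : Nonempty ((Scheme.Modules.pullback (DualPair.unitHatSlice D₀)).obj D₀.P ≅ SheafOfModules.unit _))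
    (unit : ∀ i, Nonempty ((Scheme.Modules.pullback (DualPair.unitHatSlice (𝔔.Dc i))).obj (𝔔.Dc i).P ≅
      SheafOfModules.unit _)) :
    𝔔.polarizationDatum D₀ unit₀ unit = 𝔔.toPolarizationDatum D₀ (𝔔.hĜ_of_isLocallyNoetherian D₀ unit₀ unit) := rfl

/-- **The chart clause of the glued polarisation for this datum**: `λᵢ ≫ Ĝᵢ = χᵢ ≫ λ` with `Ĝᵢ` THE DUAL TRANSPORT of the
chart square — so the glued `λ` restricts to `λᵢ` along the canonical identification of duals ([MumfordFogartyKirwan1994]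
Def. 7.2 `λ`-clause; ★ (P1) `pol_lam_left_comp_Ĝ`). [cite: MumfordFogartyKirwan1994, Ch. 7 §2 Definition 7.2 (p. 129)] -/
theorem pol_lam_left_comp_Ĝ (hĜ : ∀ i, (𝔔.Dc i).hat.IsBaseChangeVia D₀.hat (𝔇.𝒰.f i) (𝔔.Ĝ D₀ i)) (i : 𝔇.𝒰.I₀) :
    (𝔔.pol i).lam.left ≫ 𝔔.Ĝ D₀ i = 𝔇.χ i ≫ (𝔔.toPolarizationDatum D₀ hĜ).polarization.lam.left :=
  (𝔔.toPolarizationDatum D₀ hĜ).pol_lam_left_comp_Ĝ i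

/-- **Uniqueness of the glued polarisation for this datum**: a polarisation `λ'` of `Z` (for `D₀`) whose restriction to
every chart is `λᵢ` along the dual transports — `χᵢ ≫ λ' = λᵢ ≫ Ĝᵢ` — IS the glued one (★ (P1) `eq_glueLam`).
[cite: GortzWedhorn2020, Section (3.3) Proposition 3.5] [cite: MumfordFogartyKirwan1994, Ch. 6 §2 Definition 6.3 (p. 120)] -/
theorem polarization_lam_eq_of_chart (hĜ : ∀ i, (𝔔.Dc i).hat.IsBaseChangeVia D₀.hat (𝔇.𝒰.f i) (𝔔.Ĝ D₀ i))
    (pol' : 𝔇.abelianScheme.Polarization D₀) (h : ∀ i, 𝔇.χ i ≫ pol'.lam.left = (𝔔.pol i).lam.left ≫ 𝔔.Ĝ D₀ i) :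
    pol'.lam = (𝔔.toPolarizationDatum D₀ hĜ).polarization.lam :=
  (𝔔.toPolarizationDatum D₀ hĜ).eq_glueLam pol'.lam h

end PolarizationChartDatum

end ZariskiGluingDatum

end AbelianSchemeOver

end Literature.AlgebraicGeometry.AbelianSchemes

end
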